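import Mathlib
import HarnessLib

/-!
# The Brascamp–Lieb variance inequality for log-concave measures

`Literature/Probability/Distributions/`. Brascamp–Lieb 1976, Theorem 4.1 (J. Funct. Anal. 22,
pp. 375–376): for `F(x) = exp[−f(x)]` on `ℝⁿ` with `f ∈ C²` strictly convex (the proof divides
by `f″`/inverts `f_xx`, so "strictly convex" is read as `f_xx(x) > 0` positive definite for every
`x`) having a minimum, `∫ F dx < ∞`, and for every `h ∈ C¹(ℝⁿ)` with `var h < ∞` (variance with
respect to the probability measure `F dx / ∫ F dx`)

  `var h ≤ ⟨(h_x, (f_xx)⁻¹ h_x)⟩`,        `⟨A⟩ := ∫ A F dx / ∫ F dx`,  `h_x = ∇h`.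

Consequence used downstream (uniformly log-concave case `f_xx ≥ ρ·1`): the Poincaré inequality
`var h ≤ ρ⁻¹ ⟨|∇h|²⟩` with a dimension-free constant — the input for `N`-uniform moment bounds of
Gibbs measures of pinned oscillator chains (grounds
`Summit.AtomisticToContinuum.FouriersLaw.Theses.OddSectorIrreversibility.CurrentVarianceLinear`,
and the Brascamp–Lieb step of `Summit.QuantumFields.YangMills.Theses.ConvexGribovBody.BrascampLiebVacuum`).

Conventions follow `GaussianPoincareVariance`: functions on `Fin n → ℝ`, partial derivatives
`∂ᵢφ(x) = fderiv ℝ φ x (Pi.single i 1)`. The right-hand side of (4.5) is written as an extended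
(`ℝ≥0∞`) integral, so that — as in print — the inequality is vacuous when it diverges; the
left-hand side is Mathlib's `evariance` (`= var h` as `h ∈ L²`). Statement only (named fact,
`def … : Prop`); no proof is claimed here.

References: H. J. Brascamp, E. H. Lieb, *On extensions of the Brunn–Minkowski and
Prékopa–Leindler theorems, including inequalities for log concave functions, and with an
application to the diffusion equation*, J. Funct. Anal. 22 (1976) 366–389, Thm 4.1.
[BrascampLieb1976]
-/

noncomputable section

open MeasureTheory ProbabilityTheory
open scoped ENNReal Matrix

namespace Literature.Probability.Distributions

variable {n : ℕ}

/-- The gradient of `h : ℝⁿ → ℝ` in coordinates: `(∇h(x))ᵢ = ∂ᵢh(x) = Dh(x)·eᵢ`. [folklore] -/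
def coordGradient (h : (Fin n → ℝ) → ℝ) (x : Fin n → ℝ) : Fin n → ℝ :=
  fun i => fderiv ℝ h x (Pi.single i 1)

/-- The Hessian matrix of `f : ℝⁿ → ℝ` in coordinates: `(f_xx(x))ᵢⱼ = ∂ᵢ∂ⱼ f(x)`
(Brascamp–Lieb's "second derivatives matrix `f_xx`", p. 375). [cite: BrascampLieb1976, §4 p. 375] -/
def coordHessian (f : (Fin n → ℝ) → ℝ) (x : Fin n → ℝ) : Matrix (Fin n) (Fin n) ℝ :=
  Matrix.of fun i j => fderiv ℝ (fun y => fderiv ℝ f y (Pi.single j 1)) x (Pi.single i 1)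

/-- The log-concave probability measure with density `F = e^{−f}`: `F dx / ∫ F dx`
(Brascamp–Lieb's `⟨A⟩ = ∫ A F / ∫ F`, eq. (4.3)). If `∫ F = ∞` the normalising factor is the junk
value `∞⁻¹ = 0`. [cite: BrascampLieb1976, §4 eq. (4.3)] -/
def logConcaveMeasure (f : (Fin n → ℝ) → ℝ) : Measure (Fin n → ℝ) :=
  (∫⁻ x, ENNReal.ofReal (Real.exp (-f x)))⁻¹ •
    volume.withDensity fun x => ENNReal.ofReal (Real.exp (-f x))

/-- **Brascamp–Lieb 1976, Theorem 4.1** (variance inequality for log-concave measures), as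
printed on pp. 375–376: "Let `F(x) = exp[−f(x)]`, `x ∈ ℝⁿ`, let `f` be twice continuously
differentiable and let `f` be strictly convex [read: `f_xx(x)` positive definite for all `x` —
the proof inverts `f_xx`]. Let `f` have a minimum, so that `F` decreases exponentially in all
directions; then `∫_{ℝⁿ} F(x) dx < ∞`. Let `h ∈ C¹(ℝⁿ)`, and let `var h < ∞`. Then
`var h ≤ ⟨(h_x, (f_xx)⁻¹ h_x)⟩` (4.5), where the inner product is with respect to `ℂⁿ`, and `h_x`
denotes the gradient of `h`." Here `⟨·⟩` and `var` are taken with respect to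
`logConcaveMeasure f = F dx / ∫ F dx`; the right side of (4.5) is stated as an extended integral.
Grounds `Summit.AtomisticToContinuum.FouriersLaw.Theses.OddSectorIrreversibility.CurrentVarianceLinear`
(via the corollary `var h ≤ ρ⁻¹⟨|∇h|²⟩` when `f_xx ≥ ρ·1`). [cite: BrascampLieb1976, Thm 4.1] -/
def BrascampLieb1976_thm41 : Prop :=
  ∀ (n : ℕ) (f : (Fin n → ℝ) → ℝ), ContDiff ℝ 2 f → (∀ x, (coordHessian f x).PosDef) →
    (∃ x₀, ∀ x, f x₀ ≤ f x) →
      (∫⁻ x, ENNReal.ofReal (Real.exp (-f x))) < ∞ ∧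
        ∀ h : (Fin n → ℝ) → ℝ, ContDiff ℝ 1 h → MemLp h 2 (logConcaveMeasure f) →
          evariance h (logConcaveMeasure f) ≤
            ∫⁻ x, ENNReal.ofReal
              (coordGradient h x ⬝ᵥ ((coordHessian f x)⁻¹ *ᵥ coordGradient h x))
                ∂(logConcaveMeasure f)

end Literature.Probability.Distributions

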